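import Literature.NumberTheory.Rogawski1990.UnitStableOrbitalIntegralHSideValue     -- ★ L5 (B-p10 g24): `exists_classOrbitalIntegral_indicator_eq_paritySum`, `stableOrbitalIntegralRel_indicator_eq_flicker_of_eigenframe`
import Literature.NumberTheory.Rogawski1990.LocalTransferCompactSideJunctionCM         -- ★ `compactSpace_centralizer_fst_iff_of_isLocalStablyConjH`, `isLocalGRegular_of_isLocalStablyConjH`
import Literature.NumberTheory.Rogawski1990.FinExplicitTransferFactor                  -- ★ `finHeckeValue`
import HarnessLib

/-!
# The UNGUARDED rank-one unstable letter at `μ = 1`, `f = 𝟙_{K_H}`: the left side of (4.9.2) on the type-(1) torus is `√D · (−1)^e · (−q)^N`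
# (the parity computation behind `not_rankOneUnstableTransferNonsplit`; Rogawski 1990 Lemma 4.9.3, Flicker 1998 §6)

Topic `NumberTheory/Rogawski1990`; namespace `Literature.NumberTheory.Rogawski1990`.  THEOREMS ONLY (no definition, no instance, no notation, no named fact,
no `sorry`).  Cell `pub/hodgecm-mathlib` (D-0151), crux H413 = stmt-HodgeConjecture-24833, line «N6nsGerm»; LEAD F0P3a-plan (g10) WORD T9-1 (1) «NEGATIVE LEMMA →
p08 (g14)» (computation B-p10 (g25) census b80aed6c §2 v2, finding F0P3-p02 (g12) 08:05:28Z); seat F0P3a-p08 (g14); census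
`F0/P3a/F0P3a-p08/g14/CENSUS-R1lcObstruction-NegativeLemma.F0P3a-p08g14.md`.  FILE A of three (B: the torus family and the place-generic refutation; C: the
concrete place and `not_rankOneUnstableTransferNonsplit`).  HONEST LABEL: HC_CM is proved only modulo the 2 remaining named inputs (hLiu418, h413) until rung 0
closes; this file is unconditional arithmetic over ★ L5.

THE MATHEMATICS.  The unguarded letter ★ `RankOneUnstableTransferNonsplit` (ED. 2 text) quantifies over EVERY Hecke character `μ`; at `μ = 1` its left side at an
`H`-regular point `t = (δ, γ₁)` of the type-(1) torus (eigenframe `δ Q = Q·diag(u)`, `u₀ ≠ u₁` of norm one, `|u₀ − u₁|_w = |ϖ^N|`) with `f = 𝟙_{K₂ ×ˢ K₁}` reads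
`μ_w(u₀ − u₁)⁻¹ · √(Π_w ‖u₀ − u₁‖_w) · (2Φ(⟦t⟧, 𝟙) − Σ_{st} Φ) = 1 · √D · (2·S_e(N) − (S₀(N) + S₁(N)))`, where `S_e(N) = Σ_{j ≤ N, j ≡ e} w(j)` (`w(0) = 1`,
`w(j) = q^{j−1}(q+1)`) is the per-class value ★ L5 `exists_classOrbitalIntegral_indicator_eq_paritySum` (the parity `e` is FIXED BY THE FRAME: `e = 0 ⟺ ord_w ⟨q₀,q₀⟩`
even) and `S₀ + S₁ = (q^N(q+1) − 2)∕(q − 1)` is ★ `stableOrbitalIntegralRel_indicator_eq_flicker_of_eigenframe`.  The alternating sum telescopes: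
`S₀(N) − S₁(N) = Σ_{j ≤ N} (−1)^j w(j) = (−q)^N`, so the left side is `√D · (−1)^e · (−q)^N` — a non-zero real number whose SIGN ALTERNATES WITH `N`.  (The guarded
letter has `μ_w(ϖ) = −1`, which kills the alternation: `μ_w(u₀−u₁)⁻¹ = (−1)^N·unit`.)

* §1 `cast_evenGluingSum_sub_oddGluingSum` — `S₀(N) − S₁(N) = (−1)^N q^N`; `two_mul_paritySum_sub_div_eq` — `2·S_e(N) − (q^N(q+1) − 2)∕(q−1) = (−1)^e(−q)^N`.
* §2 `finHeckeValue_one` — `μ_v = 1` for the trivial Hecke character.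
* §3 **`rankOne_lhs_indicator_one_eq_of_eigenframe`** — the displayed evaluation, in the letter's token order (`P := Q`).

## References
* [Rogawski1990] J. D. Rogawski, *Automorphic Representations of Unitary Groups in Three Variables*, Ann. of Math. Stud. 123 (1990): §4.9 Lemma 4.9.3, (4.9.2) p. 56;
  §4.3 (4.3.1) p. 43.
* [Flicker1998UnitaryFL] Y. Z. Flicker, *Elementary proof of the fundamental lemma for a unitary group*, Canad. J. Math. 50 (1998): §6 p. 95 and REMARK.
* [LabesseLanglands1979] J.-P. Labesse, R. P. Langlands, *L-indistinguishability for SL(2)*, Canad. J. Math. 31 (1979): §2 (the character `μ` with `μ|F^× = ω`).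
-/

set_option autoImplicit false

noncomputable section

open MeasureTheory NumberField IsDedekindDomain Matrix Finset ValuativeRel
open scoped ValuativeRel Matrix MatrixGroups

namespace Literature.NumberTheory.Rogawski1990

open Literature.NumberTheory.Automorphic Literature.NumberTheory.Automorphic.UnitaryGroup Literature.NumberTheory.GaloisRepresentations

/-! ## §1 The alternating gluing sum -/

section Arithmetic

/-- **`S₀(N) − S₁(N) = (−q)^N`**: the EVEN minus the ODD gluing sum telescopes (`1 − (q+1) + q(q+1) − q²(q+1) + ⋯`). [cite: Flicker1998UnitaryFL, §6 p. 95 REMARK] -/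
theorem cast_evenGluingSum_sub_oddGluingSum {K : Type*} [CommRing K] (q N : ℕ) :
    ((∑ j ∈ (range (N + 1)).filter (fun j => j % 2 = 0), (if j = 0 then 1 else q ^ (j - 1) * (q + 1)) : ℕ) : K) -
      ((∑ j ∈ (range (N + 1)).filter (fun j => j % 2 = 1), (if j = 0 then 1 else q ^ (j - 1) * (q + 1)) : ℕ) : K) = (-1 : K) ^ N * (q : K) ^ N := by
  -- both parity sums as sums over `range (N+1)` of `if`-weighted terms, then one alternating sum
  have hE : ((∑ j ∈ (range (N + 1)).filter (fun j => j % 2 = 0), (if j = 0 then 1 else q ^ (j - 1) * (q + 1)) : ℕ) : K) =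
      ∑ j ∈ range (N + 1), (if j % 2 = 0 then (((if j = 0 then 1 else q ^ (j - 1) * (q + 1) : ℕ)) : K) else 0) := by
    rw [Finset.sum_filter, Nat.cast_sum]
    refine Finset.sum_congr rfl fun j _ => ?_
    split_ifs <;> simp
  have hO : ((∑ j ∈ (range (N + 1)).filter (fun j => j % 2 = 1), (if j = 0 then 1 else q ^ (j - 1) * (q + 1)) : ℕ) : K) =
      ∑ j ∈ range (N + 1), (if j % 2 = 1 then (((if j = 0 then 1 else q ^ (j - 1) * (q + 1) : ℕ)) : K) else 0) := by
    rw [Finset.sum_filter, Nat.cast_sum]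
    refine Finset.sum_congr rfl fun j _ => ?_
    split_ifs <;> simp
  have hD : ∀ j : ℕ, ((if j % 2 = 0 then (((if j = 0 then 1 else q ^ (j - 1) * (q + 1) : ℕ)) : K) else 0) -
      (if j % 2 = 1 then (((if j = 0 then 1 else q ^ (j - 1) * (q + 1) : ℕ)) : K) else 0)) =
      (-1 : K) ^ j * (((if j = 0 then 1 else q ^ (j - 1) * (q + 1) : ℕ)) : K) := by
    intro j
    rcases Nat.even_or_odd j with hj | hj
    · have h0 : j % 2 = 0 := Nat.even_iff.1 hj
      have h1 : ¬ j % 2 = 1 := by omega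
      rw [if_pos h0, if_neg h1, hj.neg_one_pow]
      ring
    · have h1 : j % 2 = 1 := Nat.odd_iff.1 hj
      have h0 : ¬ j % 2 = 0 := by omega
      rw [if_neg h0, if_pos h1, hj.neg_one_pow]
      ring
  rw [hE, hO, ← Finset.sum_sub_distrib, Finset.sum_congr rfl fun j _ => hD j]
  clear hE hO
  -- induction on `N`
  induction N with
  | zero => simp
  | succ N ih =>
    rw [Finset.sum_range_succ, ih, if_neg (Nat.succ_ne_zero N), Nat.succ_sub_one]
    push_cast
    ring

/-- **`2·S_e(N) − (q^N(q+1) − 2)∕(q − 1) = (−1)^e · (−q)^N`** (`e ∈ {0,1}`, `2 ≤ q`, characteristic `0`): twice one parity class minus the stable sum (★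
`cast_sum_gluingWeight_eq_div`, ★ `sum_gluingWeight_eq_even_add_odd`) is `±` the alternating sum. [cite: Flicker1998UnitaryFL, §6 p. 95] -/
theorem two_mul_paritySum_sub_div_eq {K : Type*} [Field K] [CharZero K] {q : ℕ} (hq : 2 ≤ q) (N : ℕ) {e : ℕ} (he : e ≤ 1) :
    2 * ((∑ j ∈ (range (N + 1)).filter (fun j => j % 2 = e), (if j = 0 then 1 else q ^ (j - 1) * (q + 1)) : ℕ) : K) -
      ((q : K) ^ N * (q + 1) - 2) / (q - 1) = (-1 : K) ^ e * ((-1 : K) ^ N * (q : K) ^ N) := by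
  rw [← HSideGluingSum.cast_sum_gluingWeight_eq_div hq N, HSideGluingSum.sum_gluingWeight_eq_even_add_odd q N, Nat.cast_add,
    ← cast_evenGluingSum_sub_oddGluingSum (K := K) q N]
  rcases Nat.le_one_iff_eq_zero_or_eq_one.1 he with rfl | rfl
  · rw [pow_zero, one_mul]; ring
  · rw [pow_one]; ring

end Arithmetic

/-! ## §2 The trivial Hecke character -/

section Trivial

variable (L : Type) [Field L] [NumberField L] (v : HeightOneSpectrum (𝓞 ↥(maximalRealSubfield L)))

/-- `μ_v = 1` at every unit for the TRIVIAL Hecke character `μ = 1` (★ `finHeckeValue_of_isUnit`, ★ `HeckeCharacter.one_apply`). [cite: Rogawski1990, §4.9 p. 55] -/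
theorem finHeckeValue_one {x : LocalRing L v} (hx : IsUnit x) : finHeckeValue L v (1 : HeckeCharacter L) x = 1 := by
  rw [finHeckeValue_of_isUnit L v (1 : HeckeCharacter L) hx, UnitaryGroup.semilocalComponent_apply, HeckeCharacter.one_apply, Units.val_one]

/-- `2 ≤ q_v`. [cite: NeukirchANT1999, Ch. I §3] -/
private theorem two_le_natCard_quotient' : 2 ≤ Nat.card (𝓞 ↥(maximalRealSubfield L) ⧸ v.asIdeal) := by
  classical
  haveI : Finite (𝓞 ↥(maximalRealSubfield L) ⧸ v.asIdeal) := Ideal.finiteQuotientOfFreeOfNeBot v.asIdeal v.ne_bot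
  haveI : Nontrivial (𝓞 ↥(maximalRealSubfield L) ⧸ v.asIdeal) := Ideal.Quotient.nontrivial_iff.2 v.isPrime.ne_top
  exact Finite.one_lt_card

/-- In the eigenframe, `Q⁻¹ δ Q = diag(u)`. [cite: Rogawski1990, §3.6 p. 31] -/
theorem unitsInv_mul_mul_eq_diagonal_of_eigenframe {R : Type*} [CommRing R] {δ : Matrix (Fin 2) (Fin 2) R} {Q : GL (Fin 2) R} {u : Fin 2 → R}
    (hQ : δ * Q.val = Q.val * diagonal u) : (Q⁻¹).val * δ * Q.val = diagonal u := by
  rw [Matrix.mul_assoc, hQ, ← Matrix.mul_assoc, Units.inv_mul, Matrix.one_mul]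

end Trivial

/-! ## §3 The left side of the unguarded (4.9.2) at `μ = 1`, `f = 𝟙_{K_H}`, on the type-(1) torus -/

section Lhs

variable (L : Type) [Field L] [NumberField L] [IsCMField L] (v : HeightOneSpectrum (𝓞 ↥(maximalRealSubfield L)))
  (w : PlacesOver L v) (hw : IsCMField.complexConj L • w.1 = w.1)

variable
  [MeasurableSpace ((cmDatum L 2 (Matrix.of fun i j : Fin 2 => if i.val + j.val + 1 = 2 then (1 : L) else 0)).Local v × (cmDatum L 1 (Matrix.of fun i j : Fin 1 => if i.val + j.val + 1 = 1 then (1 : L) else 0)).Local v)] [BorelSpace ((cmDatum L 2 (Matrix.of fun i j : Fin 2 => if i.val + j.val + 1 = 2 then (1 : L) else 0)).Local v × (cmDatum L 1 (Matrix.of fun i j : Fin 1 => if i.val + j.val + 1 = 1 then (1 : L) else 0)).Local v)]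
  [∀ a : (cmDatum L 2 (Matrix.of fun i j : Fin 2 => if i.val + j.val + 1 = 2 then (1 : L) else 0)).Local v × (cmDatum L 1 (Matrix.of fun i j : Fin 1 => if i.val + j.val + 1 = 1 then (1 : L) else 0)).Local v, MeasurableSpace (((cmDatum L 2 (Matrix.of fun i j : Fin 2 => if i.val + j.val + 1 = 2 then (1 : L) else 0)).Local v × (cmDatum L 1 (Matrix.of fun i j : Fin 1 => if i.val + j.val + 1 = 1 then (1 : L) else 0)).Local v) ⧸ Subgroup.centralizer ({a} : Set ((cmDatum L 2 (Matrix.of fun i j : Fin 2 => if i.val + j.val + 1 = 2 then (1 : L) else 0)).Local v × (cmDatum L 1 (Matrix.of fun i j : Fin 1 => if i.val + j.val + 1 = 1 then (1 : L) else 0)).Local v)))]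
  [∀ a : (cmDatum L 2 (Matrix.of fun i j : Fin 2 => if i.val + j.val + 1 = 2 then (1 : L) else 0)).Local v × (cmDatum L 1 (Matrix.of fun i j : Fin 1 => if i.val + j.val + 1 = 1 then (1 : L) else 0)).Local v, BorelSpace (((cmDatum L 2 (Matrix.of fun i j : Fin 2 => if i.val + j.val + 1 = 2 then (1 : L) else 0)).Local v × (cmDatum L 1 (Matrix.of fun i j : Fin 1 => if i.val + j.val + 1 = 1 then (1 : L) else 0)).Local v) ⧸ Subgroup.centralizer ({a} : Set ((cmDatum L 2 (Matrix.of fun i j : Fin 2 => if i.val + j.val + 1 = 2 then (1 : L) else 0)).Local v × (cmDatum L 1 (Matrix.of fun i j : Fin 1 => if i.val + j.val + 1 = 1 then (1 : L) else 0)).Local v)))]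
  (νH : Measure ((cmDatum L 2 (Matrix.of fun i j : Fin 2 => if i.val + j.val + 1 = 2 then (1 : L) else 0)).Local v × (cmDatum L 1 (Matrix.of fun i j : Fin 1 => if i.val + j.val + 1 = 1 then (1 : L) else 0)).Local v)) [νH.IsHaarMeasure] [νH.IsMulRightInvariant]

include hw in
/-- **THE LEFT SIDE OF THE UNGUARDED (4.9.2) AT `μ = 1`, `f = 𝟙_{K₂ ×ˢ K₁}`, ON THE TYPE-(1) TORUS.**  At a non-split `v` unramified in `L`, `m_H` canonical for
(`IsLocalGRegular`, `ν_H`), `ν_H(K₂ ×ˢ K₁) = 1`, and a `G`-regular `(δ, γ₁)` with eigenframe `δ Q = Q·diag(u)`, `u₀ ≠ u₁` of norm one, `|u₀ − u₁|_w = |ϖ_v^N|`, `Z(δ)`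
compact: there is `e ∈ {0,1}` — FIXED BY THE FRAME (`e = 0 ⟺ ord_w (ᵗσQ Φ₂ Q)₀₀` even) — with
`μ_v(u₀ − u₁)⁻¹|_{μ=1} · √(Π_w ‖(u₀ − u₁)_w‖) · (2Φ(⟦(δ,γ₁)⟧, 𝟙) − Σᶠ_{d ∼_st (δ,γ₁)} Φ(d, 𝟙)) = √(Π_w ‖(u₀ − u₁)_w‖) · (−1)^e · (−q_v)^N`
(the letter's left side with `P := Q`, read through `Q⁻¹ δ Q = diag(u)`).  Per-class value ★ L5, stable value ★ Flicker head (its `hcpt`∕`hreg` binders paid by ★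
`compactSpace_centralizer_fst_iff_of_isLocalStablyConjH` ∕ ★ `isLocalGRegular_of_isLocalStablyConjH`), arithmetic §1, `μ_v = 1` §2.
[cite: Rogawski1990, §4.9 Lemma 4.9.3 (4.9.2) p. 56] [cite: Flicker1998UnitaryFL, §6 p. 95] -/
theorem rankOne_lhs_indicator_one_eq_of_eigenframe (hunr : Algebra.IsUnramifiedIn (𝓞 L) v.asIdeal)
    {mH : OrbitalMeasureFamily ((cmDatum L 2 (Matrix.of fun i j : Fin 2 => if i.val + j.val + 1 = 2 then (1 : L) else 0)).Local v × (cmDatum L 1 (Matrix.of fun i j : Fin 1 => if i.val + j.val + 1 = 1 then (1 : L) else 0)).Local v)} (hmH : mH.IsCanonical (IsLocalGRegular L v) νH)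
    (hνH : νH (((cmLocalIntegralLevel L 2 (Matrix.of fun i j : Fin 2 => if i.val + j.val + 1 = 2 then (1 : L) else 0) v).prod (cmLocalIntegralLevel L 1 (Matrix.of fun i j : Fin 1 => if i.val + j.val + 1 = 1 then (1 : L) else 0) v) : Subgroup ((cmDatum L 2 (Matrix.of fun i j : Fin 2 => if i.val + j.val + 1 = 2 then (1 : L) else 0)).Local v × (cmDatum L 1 (Matrix.of fun i j : Fin 1 => if i.val + j.val + 1 = 1 then (1 : L) else 0)).Local v)) : Set ((cmDatum L 2 (Matrix.of fun i j : Fin 2 => if i.val + j.val + 1 = 2 then (1 : L) else 0)).Local v × (cmDatum L 1 (Matrix.of fun i j : Fin 1 => if i.val + j.val + 1 = 1 then (1 : L) else 0)).Local v)) = 1)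
    (δ : (cmDatum L 2 (Matrix.of fun i j : Fin 2 => if i.val + j.val + 1 = 2 then (1 : L) else 0)).Local v) (γ₁ : (cmDatum L 1 (Matrix.of fun i j : Fin 1 => if i.val + j.val + 1 = 1 then (1 : L) else 0)).Local v) (hγ : IsLocalGRegular L v (δ, γ₁))
    [CompactSpace (Subgroup.centralizer ({δ} : Set ((cmDatum L 2 (Matrix.of fun i j : Fin 2 => if i.val + j.val + 1 = 2 then (1 : L) else 0)).Local v)))]
    {Q : GL (Fin 2) (LocalRing L v)} {u : Fin 2 → LocalRing L v}
    (hQ : δ.val.val * Q.val = Q.val * diagonal u)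
    (hu : Function.Injective u) (hu1 : ∀ i, conjLocal L (IsCMField.complexConj L) v (u i) * u i = 1) {N : ℕ}
    (hN : valuation (w.1.adicCompletion L) (u 0 w - u 1 w) = valuation (w.1.adicCompletion L) ((toPlace v w (HeckeCharacter.uniformizer ↥(maximalRealSubfield L) v : v.adicCompletion ↥(maximalRealSubfield L))) ^ N)) :
    ∃ e : ℕ, e ≤ 1 ∧
      (Even (WithZero.log (Valued.v ((twistGram (conjLocal L (IsCMField.complexConj L) v) ((adelicForm L 2 (Matrix.of fun i j : Fin 2 => if i.val + j.val + 1 = 2 then (1 : L) else 0)).map (adeleToLocal L v)) Q.val 0 0) w))) ↔ e = 0) ∧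
      ((finHeckeValue L v (1 : HeckeCharacter L)
          (((Q⁻¹).val * (δ.val.val : Matrix (Fin 2) (Fin 2) (LocalRing L v)) * Q.val) 0 0 - ((Q⁻¹).val * (δ.val.val : Matrix (Fin 2) (Fin 2) (LocalRing L v)) * Q.val) 1 1))⁻¹ : ℂ) *
        ((Real.sqrt (∏ w' : PlacesOver L v,
            ‖(((Q⁻¹).val * (δ.val.val : Matrix (Fin 2) (Fin 2) (LocalRing L v)) * Q.val) 0 0 - ((Q⁻¹).val * (δ.val.val : Matrix (Fin 2) (Fin 2) (LocalRing L v)) * Q.val) 1 1) w'‖) : ℝ) : ℂ) *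
        (2 * classOrbitalIntegral mH ((((cmLocalIntegralLevel L 2 (Matrix.of fun i j : Fin 2 => if i.val + j.val + 1 = 2 then (1 : L) else 0) v).prod (cmLocalIntegralLevel L 1 (Matrix.of fun i j : Fin 1 => if i.val + j.val + 1 = 1 then (1 : L) else 0) v) : Subgroup ((cmDatum L 2 (Matrix.of fun i j : Fin 2 => if i.val + j.val + 1 = 2 then (1 : L) else 0)).Local v × (cmDatum L 1 (Matrix.of fun i j : Fin 1 => if i.val + j.val + 1 = 1 then (1 : L) else 0)).Local v)) : Set ((cmDatum L 2 (Matrix.of fun i j : Fin 2 => if i.val + j.val + 1 = 2 then (1 : L) else 0)).Local v × (cmDatum L 1 (Matrix.of fun i j : Fin 1 => if i.val + j.val + 1 = 1 then (1 : L) else 0)).Local v)).indicator fun _ => (1 : ℂ)) (ConjClasses.mk (δ, γ₁)) -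
          ∑ᶠ d ∈ {d : ConjClasses ((cmDatum L 2 (Matrix.of fun i j : Fin 2 => if i.val + j.val + 1 = 2 then (1 : L) else 0)).Local v × (cmDatum L 1 (Matrix.of fun i j : Fin 1 => if i.val + j.val + 1 = 1 then (1 : L) else 0)).Local v) | IsLocalStablyConjH L v (δ, γ₁) (Quotient.out d)},
            classOrbitalIntegral mH ((((cmLocalIntegralLevel L 2 (Matrix.of fun i j : Fin 2 => if i.val + j.val + 1 = 2 then (1 : L) else 0) v).prod (cmLocalIntegralLevel L 1 (Matrix.of fun i j : Fin 1 => if i.val + j.val + 1 = 1 then (1 : L) else 0) v) : Subgroup ((cmDatum L 2 (Matrix.of fun i j : Fin 2 => if i.val + j.val + 1 = 2 then (1 : L) else 0)).Local v × (cmDatum L 1 (Matrix.of fun i j : Fin 1 => if i.val + j.val + 1 = 1 then (1 : L) else 0)).Local v)) : Set ((cmDatum L 2 (Matrix.of fun i j : Fin 2 => if i.val + j.val + 1 = 2 then (1 : L) else 0)).Local v × (cmDatum L 1 (Matrix.of fun i j : Fin 1 => if i.val + j.val + 1 = 1 then (1 : L) else 0)).Local v)).indicator fun _ => (1 : ℂ))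 d) =
        ((Real.sqrt (∏ w' : PlacesOver L v, ‖(u 0 - u 1) w'‖) : ℝ) : ℂ) *
          ((-1 : ℂ) ^ e * ((-1 : ℂ) ^ N * (Nat.card (𝓞 ↥(maximalRealSubfield L) ⧸ v.asIdeal) : ℂ) ^ N)) := by
  have hv : Subsingleton (PlacesOver L v) :=
    PlacesOver.subsingleton_of_smul_eq (IsCMField.complexConj L) (IsCMField.complexConj_ne_one L) w hw
  -- the frame reading `Q⁻¹ δ Q = diag(u)`
  have hdiag : (Q⁻¹).val * (δ.val.val : Matrix (Fin 2) (Fin 2) (LocalRing L v)) * Q.val = diagonal u := unitsInv_mul_mul_eq_diagonal_of_eigenframe hQ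
  have h00 : ((Q⁻¹).val * (δ.val.val : Matrix (Fin 2) (Fin 2) (LocalRing L v)) * Q.val) 0 0 = u 0 := by rw [hdiag, diagonal_apply_eq]
  have h11 : ((Q⁻¹).val * (δ.val.val : Matrix (Fin 2) (Fin 2) (LocalRing L v)) * Q.val) 1 1 = u 1 := by rw [hdiag, diagonal_apply_eq]
  -- `u₀ − u₁` is a unit of `E_v` (non-zero at the one place `w`)
  have hne : u 0 - u 1 ≠ 0 := by
    intro h0
    have hw0 : u 0 w - u 1 w = 0 := by rw [← Pi.sub_apply, h0, Pi.zero_apply]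
    rw [hw0, map_zero] at hN
    exact ((Valuation.ne_zero_iff _).2 (pow_ne_zero _ (toPlace_uniformizer_ne_zero L v w hunr))) hN.symm
  have hunit : IsUnit (u 0 - u 1) := isUnit_localRing_of_ne_zero_of_subsingleton L v hv hne
  -- per-class value and stable value (★ L5, ★ Flicker head)
  obtain ⟨e, he, hpar, hval⟩ := exists_classOrbitalIntegral_indicator_eq_paritySum L v w hw νH hunr hmH hνH δ γ₁ hγ hQ hu hu1 hN
  have hcpt : ∀ δ' : (cmDatum L 2 (Matrix.of fun i j : Fin 2 => if i.val + j.val + 1 = 2 then (1 : L) else 0)).Local v,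
      IsStablyConj (conjLocal L (IsCMField.complexConj L) v) ((adelicForm L 2 (Matrix.of fun i j : Fin 2 => if i.val + j.val + 1 = 2 then (1 : L) else 0)).map (adeleToLocal L v)) δ δ' →
      CompactSpace (Subgroup.centralizer ({δ'} : Set ((cmDatum L 2 (Matrix.of fun i j : Fin 2 => if i.val + j.val + 1 = 2 then (1 : L) else 0)).Local v))) := fun δ' hst =>
    (compactSpace_centralizer_fst_iff_of_isLocalStablyConjH L v (γH := (δ, γ₁)) (δH := (δ', γ₁)) hγ ⟨hst, IsStablyConj.refl _⟩).1 inferInstance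
  have hreg : ∀ δ' : (cmDatum L 2 (Matrix.of fun i j : Fin 2 => if i.val + j.val + 1 = 2 then (1 : L) else 0)).Local v,
      IsStablyConj (conjLocal L (IsCMField.complexConj L) v) ((adelicForm L 2 (Matrix.of fun i j : Fin 2 => if i.val + j.val + 1 = 2 then (1 : L) else 0)).map (adeleToLocal L v)) δ δ' →
      IsLocalGRegular L v (δ', γ₁) := fun δ' hst =>
    isLocalGRegular_of_isLocalStablyConjH L v (γH := (δ, γ₁)) (δH := (δ', γ₁)) ⟨hst, IsStablyConj.refl _⟩ hγ
  have hst := stableOrbitalIntegralRel_indicator_eq_flicker_of_eigenframe L v w hw νH hunr hmH hνH δ γ₁ hγ hQ hu hu1 hN hcpt hreg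
  rw [stableOrbitalIntegralRel_def] at hst
  refine ⟨e, he, hpar, ?_⟩
  rw [h00, h11, finHeckeValue_one L v hunit, inv_one, one_mul, hval, hst]
  congr 1
  exact two_mul_paritySum_sub_div_eq (two_le_natCard_quotient' L v) N he

end Lhs

end Literature.NumberTheory.Rogawski1990

end
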